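import Summits.CriticalPhenomena.PercolationContinuityZ3.Theorems.PercNearOneGluingNoHeavyLowerTailSunflowerMultiPetalSingleton
import Summits.CriticalPhenomena.PercolationContinuityZ3.Theorems.PercNearOneGluingNoHeavyLowerTailSunflowerMultiPetalComap
import Summits.CriticalPhenomena.PercolationContinuityZ3.Theorems.PercNearOneGluingNoHeavyLowerTailSunflowerRestrictionSeriesPair
import HarnessLib
import HarnessLib.Audit

/-!
# `NoHeavyLowerTail` (crux stmt-CriticalPhenomena-4575), abstract sunflower cubic, `k` petals: the PENDANT IDENTITY
# `Z(W + e) = 2·Z(W) + Z(W; contracted at e)` for a coordinate `e` that acts only through one other coordinate `u`,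
# the PENDANT INEQUALITY `Z(W + e) ≥ 2·Z(W) + Z(W − u)` when `{u,e}` is not a bottom set, and ★ₖ for every structure
# admitting a PENDANT / INERT ELIMINATION ORDER (e.g. the coloured clutters of all FORESTS, memo §2)

Support file (seat `prim-l12-p2` gen 35; `--supports stmt-CriticalPhenomena-4575`; companions: `…SunflowerMultiPetalRestriction`
(p340634: `MSunflower.ZKW`, `nested`), `…SunflowerMultiPetalSingleton` (p343107: (MZₖ) at a non-bottom singleton),
`…SunflowerMultiPetalComap` (p368479: `MSunflower.contract`, `ZKW_contract`), `…SunflowerRestrictionSeriesPair` (p222700: the `k = 3`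
series-pair case of (MZ), `nested_insert_split`)).  Everything here is PROVED; nothing is asserted about the crux; no `sorry`.
Memo: run/shared/lean/prim/prim-l12/prim-l12-p2/FINDING-g35-GRAPH-PENCIL.md §2.

SETTING.  `F : MSunflower k α` (a monotone map `lab : 2^α → M_k`), a sub-cube `2^W`, a new coordinate `e ∉ W` and a coordinate `u`.
We say that `e` ACTS THROUGH `u` on `W` if `lab (insert e X) = lab X` for every `X ⊆ W` with `u ∉ X` (adjoining `e` changes nothing
unless `u` is present).  Examples: an INERT coordinate (take `u = e`); in the coloured-clutter structure of a graph, a PENDANT vertex `e`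
whose unique neighbour is `u`; in general, a point all of whose clutter edges contain `u`.

* `MSunflower.ZKW_insert_eq_of_actsThrough` — **PENDANT IDENTITY** (this work): if `e` acts through `u` on `W` then
  `ZKW (insert e W) = 2·ZKW W + Σ_{(X,S,T) ⊢ W} s6K (lab (e+X)) (lab (e+S)) (lab (e+T))` (the last sum is the functional of the
  CONTRACTION `F.contract {e}` on `W`, `ZKW_insert_eq_two_mul_add_contract`).  Proof: in the one-coordinate expansion
  (`nested_insert_split`) at most one block of each ordered 3-partition contains `u`, so at most one block is changed by `e`, and
  `s(ψX,φS,φT) + s(φX,ψS,φT) + s(φX,φS,ψT) = 2·s(φX,φS,φT) + s(ψX,ψS,ψT)` termwise.  (Gen-8's pencil `3b₁ − 2b₀ − b₃ = 2ΣE₁ + ΣE₂`: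
  here every exchange term vanishes.)  INERT case (`u = e`): `ZKW (insert e W) = 3·ZKW W` (`ZKW_insert_eq_three_mul_of_inert`).
* `MSunflower.ZKW_insert_ge_of_pendant` — **PENDANT INEQUALITY** (this work): if moreover `u ∈ W` and `lab {e,u} ≠ 0`, then
  `2·ZKW W + ZKW (W.erase u) ≤ ZKW (insert e W)`: the singleton `{u}` is a non-bottom set of the contraction, so p343107's (MZₖ) at a
  non-bottom singleton gives `(F.contract {e}).ZKW W ≥ (F.contract {e}).ZKW (W.erase u) = ZKW (W.erase u)`.
* `MSunflower.ZKW_nonneg_of_pendantOrder`, `MSunflower.ZK_nonneg_of_pendantOrder` — **★ₖ under a pendant/inert elimination order**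
  (this work): if every nonempty sub-cube `W` has a coordinate `e ∈ W` that is inert on `W ∖ e` or acts through some `u ∈ W ∖ e` with
  `lab {e,u} ≠ 0`, then `0 ≤ ZKW W` for all `W`, in particular `0 ≤ ZK` (strong induction on `W`).  For the coloured clutter `F_G` of a
  graph `G` (bottom = independent sets, petal `h` = sets spanning exactly the edge `h`, top = sets spanning ≥ 2 edges) the hypothesis says
  that every induced subgraph has a vertex of degree ≤ 1, i.e. `G` is a FOREST: ★ₖ holds for the (prime, saturated, injectively coloured)
  clutters of all forests, of every size (memo §2; previously known for forests only through `…MultiPetalLeFive`, ≤ 5 points).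
-/

namespace Summit.CriticalPhenomena.PercolationContinuityZ3.Theorems.SunflowerPartition

open Finset

variable {α : Type*} [DecidableEq α]

/-- Congruence of nested partition sums: two block functions that agree whenever the three blocks are subsets of `W` have the same
nested sum over the ordered 3-partitions of `W`. [this work] -/
theorem nested_congr_of_subset (W : Finset α) (G G' : Finset α → Finset α → Finset α → ℤ)
    (h : ∀ X S T : Finset α, X ⊆ W → S ⊆ W → T ⊆ W → G X S T = G' X S T) :
    nested W G = nested W G' := by
  unfold nested
  refine sum_congr rfl fun X hX => sum_congr rfl fun S hS => ?_
  have hXW : X ⊆ W := mem_powerset.1 hX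
  have hSW : S ⊆ W := (mem_powerset.1 hS).trans sdiff_subset
  have hTW : (W \ X) \ S ⊆ W := sdiff_subset.trans sdiff_subset
  exact h X S ((W \ X) \ S) hXW hSW hTW

namespace MSunflower

variable {k : ℕ} (F : MSunflower k α)

/-- **PENDANT IDENTITY** (this work).  If `e ∉ W` acts through `u` on `W` (`lab (insert e X) = lab X` for all `X ⊆ W` with `u ∉ X`), then
`ZKW (insert e W) = 2·ZKW W + Σ_{(X,S,T) ⊢ W} s6K (lab (insert e X)) (lab (insert e S)) (lab (insert e T))`. [this work] -/
theorem ZKW_insert_eq_of_actsThrough (W : Finset α) (e u : α) (he : e ∉ W)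
    (hact : ∀ X : Finset α, X ⊆ W → u ∉ X → F.lab (insert e X) = F.lab X) :
    F.ZKW (insert e W)
      = 2 * F.ZKW W + nested W (fun X S T => s6K k (F.lab (insert e X)) (F.lab (insert e S)) (F.lab (insert e T))) := by
  have key : ∀ X ∈ W.powerset, ∀ S ∈ (W \ X).powerset,
      s6K k (F.lab (insert e X)) (F.lab S) (F.lab ((W \ X) \ S))
        + s6K k (F.lab X) (F.lab (insert e S)) (F.lab ((W \ X) \ S))
        + s6K k (F.lab X) (F.lab S) (F.lab (insert e ((W \ X) \ S)))
      = 2 * s6K k (F.lab X) (F.lab S) (F.lab ((W \ X) \ S))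
        + s6K k (F.lab (insert e X)) (F.lab (insert e S)) (F.lab (insert e ((W \ X) \ S))) := by
    intro X hX S hS
    have hXW : X ⊆ W := mem_powerset.1 hX
    have hS' : S ⊆ W \ X := mem_powerset.1 hS
    have hSW : S ⊆ W := hS'.trans sdiff_subset
    have hTW : (W \ X) \ S ⊆ W := sdiff_subset.trans sdiff_subset
    by_cases huX : u ∈ X
    · have huS : u ∉ S := fun h => (mem_sdiff.1 (hS' h)).2 huX
      have huT : u ∉ (W \ X) \ S := fun h => (mem_sdiff.1 (mem_sdiff.1 h).1).2 huX
      rw [hact S hSW huS, hact _ hTW huT]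
      ring
    · rw [hact X hXW huX]
      by_cases huS : u ∈ S
      · have huT : u ∉ (W \ X) \ S := fun h => (mem_sdiff.1 h).2 huS
        rw [hact _ hTW huT]
        ring
      · rw [hact S hSW huS]
        ring
  unfold ZKW
  rw [nested_insert_split W e he]
  unfold nested
  rw [← sum_add_distrib, ← sum_add_distrib, mul_sum, ← sum_add_distrib]
  refine sum_congr rfl fun X hX => ?_
  rw [← sum_add_distrib, ← sum_add_distrib, mul_sum, ← sum_add_distrib]
  refine sum_congr rfl fun S hS => ?_
  exact key X hX S hS

/-- **INERT COORDINATE** (this work): if `e ∉ W` changes no label on `W` (`lab (insert e X) = lab X` for all `X ⊆ W`), then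
`ZKW (insert e W) = 3·ZKW W`. [this work] -/
theorem ZKW_insert_eq_three_mul_of_inert (W : Finset α) (e : α) (he : e ∉ W)
    (hinert : ∀ X : Finset α, X ⊆ W → F.lab (insert e X) = F.lab X) :
    F.ZKW (insert e W) = 3 * F.ZKW W := by
  rw [F.ZKW_insert_eq_of_actsThrough W e e he (fun X hX _ => hinert X hX)]
  have h : nested W (fun X S T => s6K k (F.lab (insert e X)) (F.lab (insert e S)) (F.lab (insert e T))) = F.ZKW W := by
    unfold ZKW
    exact nested_congr_of_subset W _ _ fun X S T hX hS hT => by rw [hinert X hX, hinert S hS, hinert T hT]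
  rw [h]
  ring

variable [Fintype α]

/-- The sub-cube functional of the contraction at one point: `(F.contract {e}).ZKW W = Σ_{(X,S,T) ⊢ W} s6K (lab (insert e X)) (lab (insert e S))
(lab (insert e T))`. [this work] -/
theorem ZKW_contract_singleton (W : Finset α) (e : α) :
    (F.contract {e}).ZKW W = nested W (fun X S T => s6K k (F.lab (insert e X)) (F.lab (insert e S)) (F.lab (insert e T))) := by
  rw [F.ZKW_contract]
  unfold nested
  refine sum_congr rfl fun X _ => sum_congr rfl fun S _ => ?_
  dsimp only
  rw [insert_eq e X, insert_eq e S, insert_eq e ((W \ X) \ S)]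

/-- **PENDANT IDENTITY, contraction form** (this work): if `e ∉ W` acts through `u` on `W` then
`ZKW (insert e W) = 2·ZKW W + (F.contract {e}).ZKW W`. [this work] -/
theorem ZKW_insert_eq_two_mul_add_contract (W : Finset α) (e u : α) (he : e ∉ W)
    (hact : ∀ X : Finset α, X ⊆ W → u ∉ X → F.lab (insert e X) = F.lab X) :
    F.ZKW (insert e W) = 2 * F.ZKW W + (F.contract {e}).ZKW W := by
  rw [F.ZKW_contract_singleton, F.ZKW_insert_eq_of_actsThrough W e u he hact]

/-- Away from `u` the contraction at a coordinate acting through `u` agrees with the structure itself: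
`(F.contract {e}).ZKW (W.erase u) = ZKW (W.erase u)`. [this work] -/
theorem ZKW_contract_erase_eq_of_actsThrough (W : Finset α) (e u : α)
    (hact : ∀ X : Finset α, X ⊆ W → u ∉ X → F.lab (insert e X) = F.lab X) :
    (F.contract {e}).ZKW (W.erase u) = F.ZKW (W.erase u) := by
  rw [F.ZKW_contract_singleton]
  unfold ZKW
  refine nested_congr_of_subset (W.erase u) _ _ fun X S T hX hS hT => ?_
  have hW : W.erase u ⊆ W := erase_subset u W
  have huX : u ∉ X := fun h => notMem_erase u W (hX h)
  have huS : u ∉ S := fun h => notMem_erase u W (hS h)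
  have huT : u ∉ T := fun h => notMem_erase u W (hT h)
  rw [hact X (hX.trans hW) huX, hact S (hS.trans hW) huS, hact T (hT.trans hW) huT]

/-- **PENDANT INEQUALITY** (this work).  If `e ∉ W` acts through `u ∈ W` on `W` and the pair `{e,u}` is not a bottom set
(`lab (insert e {u}) ≠ 0`), then `2·ZKW W + ZKW (W.erase u) ≤ ZKW (insert e W)`.  [pendant identity + (MZₖ) at the non-bottom singleton `{u}`
of the contraction `F.contract {e}` (p343107) + agreement away from `u`.] [this work] -/
theorem ZKW_insert_ge_of_pendant (W : Finset α) (e u : α) (he : e ∉ W) (hu : u ∈ W)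
    (hact : ∀ X : Finset α, X ⊆ W → u ∉ X → F.lab (insert e X) = F.lab X) (hne : F.lab (insert e {u}) ≠ 0) :
    2 * F.ZKW W + F.ZKW (W.erase u) ≤ F.ZKW (insert e W) := by
  rw [F.ZKW_insert_eq_two_mul_add_contract W e u he hact]
  have hlab : (F.contract {e}).lab {u} ≠ 0 := by
    rw [lab_contract, ← insert_eq]
    exact hne
  have h1 : (F.contract {e}).ZKW (W.erase u) ≤ (F.contract {e}).ZKW W := by
    have h := (F.contract {e}).ZKW_le_ZKW_insert_of_lab_singleton_ne_zero (W.erase u) u (notMem_erase u W) hlab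
    rwa [insert_erase hu] at h
  rw [F.ZKW_contract_erase_eq_of_actsThrough W e u hact] at h1
  linarith

/-- **★ₖ UNDER A PENDANT / INERT ELIMINATION ORDER** (this work).  Suppose every nonempty sub-cube `W` has a coordinate `e ∈ W` and a
coordinate `u` such that `e` acts through `u` on `W.erase e` and either `u = e` (i.e. `e` is inert on `W.erase e`) or `u ∈ W.erase e` with
`lab (insert e {u}) ≠ 0`.  Then `0 ≤ ZKW W` for every sub-cube `W`.  (For the coloured clutter of a graph: every induced subgraph has a vertex
of degree `≤ 1`, i.e. the graph is a forest.) [this work] -/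
theorem ZKW_nonneg_of_pendantOrder
    (hp : ∀ W : Finset α, W.Nonempty → ∃ e ∈ W, ∃ u : α,
      (∀ X : Finset α, X ⊆ W.erase e → u ∉ X → F.lab (insert e X) = F.lab X) ∧
        (u = e ∨ (u ∈ W.erase e ∧ F.lab (insert e {u}) ≠ 0))) :
    ∀ W : Finset α, 0 ≤ F.ZKW W := by
  intro W
  induction W using Finset.strongInduction with
  | H W ih =>
    by_cases hW : W.Nonempty
    · obtain ⟨e, heW, u, hact, hu⟩ := hp W hW
      have hWe : insert e (W.erase e) = W := insert_erase heW
      have he : e ∉ W.erase e := notMem_erase e W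
      have hlt : W.erase e ⊂ W := erase_ssubset heW
      have ih1 : 0 ≤ F.ZKW (W.erase e) := ih _ hlt
      rcases hu with hue | ⟨huW, hne⟩
      · -- inert coordinate
        subst hue
        have h3 := F.ZKW_insert_eq_three_mul_of_inert (W.erase u) u he (fun X hX => hact X hX (fun h => he (hX h)))
        rw [hWe] at h3
        rw [h3]
        linarith
      · -- pendant coordinate
        have h2 := F.ZKW_insert_ge_of_pendant (W.erase e) e u he huW hact hne
        rw [hWe] at h2
        have hlt' : (W.erase e).erase u ⊂ W := lt_of_le_of_lt (erase_subset u (W.erase e)) hlt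
        have ih2 : 0 ≤ F.ZKW ((W.erase e).erase u) := ih _ hlt'
        linarith
    · rw [not_nonempty_iff_eq_empty.1 hW, F.ZKW_empty]

/-- **★ₖ under a pendant / inert elimination order, whole-cube form** (this work): under the hypothesis of `ZKW_nonneg_of_pendantOrder`,
`0 ≤ ZK`. [this work] -/
theorem ZK_nonneg_of_pendantOrder
    (hp : ∀ W : Finset α, W.Nonempty → ∃ e ∈ W, ∃ u : α,
      (∀ X : Finset α, X ⊆ W.erase e → u ∉ X → F.lab (insert e X) = F.lab X) ∧
        (u = e ∨ (u ∈ W.erase e ∧ F.lab (insert e {u}) ≠ 0))) :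
    0 ≤ F.ZK := by
  rw [← F.ZKW_univ]
  exact F.ZKW_nonneg_of_pendantOrder hp univ

end MSunflower

end Summit.CriticalPhenomena.PercolationContinuityZ3.Theorems.SunflowerPartition
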